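import Mathlib
import Summits.RiemannHypothesis.RiemannHypothesis.Theorems.WeilFarCoercivityFloor
import Summits.RiemannHypothesis.RiemannHypothesis.Theorems.WeilFarFloorPerturbation
import Literature.NumberTheory.LFunctions.LittlewoodOscillationInputs
import Literature.Analysis.Fourier.DirichletIntegral
import HarnessLib

/-!
# Resonant modulation of window functions: Riemann–Lebesgue in a phase, Dirichlet resonances, the free phase

Helper file (`--supports stmt-RiemannHypothesis-0098`, lead-track anchor: Weil-positivity window ladder, format-C far bound),
pure proofs, RH-free.  Seat rh-explicit-weil-1 gen11 (memo `run/shared/lean/pub/rh-explicit/rh-explicit-weil-1/FORMAT-K3.md` §12).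
The toolkit behind `WeilFarFloorNoSpectralGap` (the windowed prime-shift form `primeShiftForm` has no `L²`-spectral gap):

* §1 Riemann–Lebesgue on the line in real form (from Mathlib `Real.tendsto_integral_exp_smul_cocompact`):
  `∫ h cos(Tx) → 0`, `∫ h sin(Tx) → 0` (`tendsto_integral_mul_cos_atTop`, `_sin_`), hence UNIFORMLY IN THE PHASE
  `|∫ h(x) cos(Tx + φ) dx| ≤ δ` for all `φ`, eventually in `T` (`eventually_abs_integral_mul_cos_add_le`).
* §2 RESONANT FREQUENCIES ARE UNBOUNDED (`exists_resonant_frequency`): for a finite set `S ⊂ ℕ`, any `T₀` and `η > 0` some `T ≥ T₀` has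
  `cos(T log n) ≥ 1 − η` for all `n ∈ S` — Dirichlet's simultaneous approximation (tree: MV Lemma 15.10
  `exists_nat_forall_abs_sub_round_lt`) for the numbers `log n/log 2` with denominator bound `R·N`, `T = 2πRq/log 2 ≥ R`.
* §3 MODULATION: `f = g·cos(T· + θ)` is admissible with `g` (`modulated_admissible`);
  `∫ f(x − ℓ)f(x) = ½cos(Tℓ)∫ g(x − ℓ)g(x) + ½∫ g(x − ℓ)g(x)cos(2Tx + 2θ − Tℓ)` (`integral_modulated_shift_mul`),
  `∫ f² = ½∫g² + ½∫ g² cos(2Tx + 2θ)` (`integral_modulated_sq`); `|∫ g(x − ℓ)g(x)| ≤ ∫g²` (`abs_integral_shift_mul_le`).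
* §4 THE FREE PHASE: for bounded measurable `c` some `θ` makes `g·cos(T· + θ) ⊥ c` (`exists_phase_orthogonal`, intermediate values of
  `A cos θ − B sin θ` on `[0, π]`).
Standard axioms only.
-/

set_option linter.dupNamespace false
set_option autoImplicit false

noncomputable section

open MeasureTheory Set Filter
open scoped Real Topology ArithmeticFunction.vonMangoldt

namespace Summit.RiemannHypothesis.RiemannHypothesis.Theorems.WeilFormatC

namespace FloorResonance

open Literature.NumberTheory.LFunctions

variable {a : ℝ}

/-! ## §1 Riemann–Lebesgue on the line, real forms, uniformly in a phase -/

/-- **Riemann–Lebesgue, cosine form**: `∫ h(x) cos(Tx) dx → 0` as `T → +∞` for integrable real `h`. [folklore] -/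
theorem tendsto_integral_mul_cos_atTop {h : ℝ → ℝ} (hh : Integrable h) :
    Tendsto (fun T : ℝ ↦ ∫ x, h x * Real.cos (T * x)) atTop (𝓝 0) := by
  set f : ℝ → ℂ := fun u ↦ (h u : ℂ) with hf
  have hRL := Real.tendsto_integral_exp_smul_cocompact f
  have hT : Tendsto (fun T : ℝ ↦ -T / (2 * π)) atTop (cocompact ℝ) :=
    (tendsto_neg_atTop_atBot.atBot_div_const (by positivity)).mono_right atBot_le_cocompact
  have h2 := hRL.comp hT
  have h3 : ∀ T : ℝ, (∫ v, Real.fourierChar (-(v * (-T / (2 * π)))) • f v) =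
      ∫ u, Complex.exp (↑(T * u) * Complex.I) * (h u : ℂ) := by
    intro T
    congr 1; ext v
    rw [hf, Circle.smul_def, Real.fourierChar_apply, smul_eq_mul]
    congr 2
    push_cast
    field_simp
  have h4 : Tendsto (fun T : ℝ ↦ ∫ u, Complex.exp (↑(T * u) * Complex.I) * (h u : ℂ)) atTop (𝓝 0) :=
    h2.congr h3
  have h5 := (Complex.continuous_re.tendsto 0).comp h4
  simp only [Complex.zero_re] at h5
  refine h5.congr fun T ↦ ?_
  have hint : Integrable (fun u ↦ Complex.exp (↑(T * u) * Complex.I) * (h u : ℂ)) :=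
    Integrable.bdd_mul hh.ofReal (Continuous.aestronglyMeasurable (by fun_prop))
      (Eventually.of_forall fun u ↦ by rw [Complex.norm_exp_ofReal_mul_I])
  have := integral_re hint
  simp only [RCLike.re_to_complex, Function.comp] at this ⊢
  rw [← this]
  congr 1; ext u
  rw [Complex.re_mul_ofReal, Complex.exp_ofReal_mul_I_re]
  ring

/-- **Riemann–Lebesgue, sine form**: `∫ h(x) sin(Tx) dx → 0` as `T → +∞` for integrable real `h`. [folklore] -/
theorem tendsto_integral_mul_sin_atTop {h : ℝ → ℝ} (hh : Integrable h) :
    Tendsto (fun T : ℝ ↦ ∫ x, h x * Real.sin (T * x)) atTop (𝓝 0) := by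
  set f : ℝ → ℂ := fun u ↦ (h u : ℂ) with hf
  have hRL := Real.tendsto_integral_exp_smul_cocompact f
  have hT : Tendsto (fun T : ℝ ↦ -T / (2 * π)) atTop (cocompact ℝ) :=
    (tendsto_neg_atTop_atBot.atBot_div_const (by positivity)).mono_right atBot_le_cocompact
  have h2 := hRL.comp hT
  have h3 : ∀ T : ℝ, (∫ v, Real.fourierChar (-(v * (-T / (2 * π)))) • f v) =
      ∫ u, Complex.exp (↑(T * u) * Complex.I) * (h u : ℂ) := by
    intro T
    congr 1; ext v
    rw [hf, Circle.smul_def, Real.fourierChar_apply, smul_eq_mul]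
    congr 2
    push_cast
    field_simp
  have h4 : Tendsto (fun T : ℝ ↦ ∫ u, Complex.exp (↑(T * u) * Complex.I) * (h u : ℂ)) atTop (𝓝 0) :=
    h2.congr h3
  have h5 := (Complex.continuous_im.tendsto 0).comp h4
  simp only [Complex.zero_im] at h5
  refine h5.congr fun T ↦ ?_
  have hint : Integrable (fun u ↦ Complex.exp (↑(T * u) * Complex.I) * (h u : ℂ)) :=
    Integrable.bdd_mul hh.ofReal (Continuous.aestronglyMeasurable (by fun_prop))
      (Eventually.of_forall fun u ↦ by rw [Complex.norm_exp_ofReal_mul_I])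
  have := integral_im hint
  simp only [RCLike.im_to_complex, Function.comp] at this ⊢
  rw [← this]
  congr 1; ext u
  rw [Complex.im_mul_ofReal, Complex.exp_ofReal_mul_I_im]
  ring

/-- Integrability of `h·cos(Tx + φ)` for integrable `h`. -/
theorem integrable_mul_cos_add {h : ℝ → ℝ} (hh : Integrable h) (T φ : ℝ) :
    Integrable (fun x ↦ h x * Real.cos (T * x + φ)) :=
  Integrable.mul_bdd hh (Continuous.aestronglyMeasurable (by fun_prop))
    (Eventually.of_forall fun u ↦ by rw [Real.norm_eq_abs]; exact Real.abs_cos_le_one _)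

/-- The phase splits off: `∫ h(x) cos(Tx + φ) = cos φ · ∫ h cos(Tx) − sin φ · ∫ h sin(Tx)`. -/
theorem integral_mul_cos_add (h : ℝ → ℝ) (hh : Integrable h) (T φ : ℝ) :
    ∫ x, h x * Real.cos (T * x + φ)
      = Real.cos φ * (∫ x, h x * Real.cos (T * x)) - Real.sin φ * (∫ x, h x * Real.sin (T * x)) := by
  have h1 : (fun x ↦ h x * Real.cos (T * x + φ))
      = fun x ↦ Real.cos φ * (h x * Real.cos (T * x)) - Real.sin φ * (h x * Real.sin (T * x)) := by
    funext x; rw [Real.cos_add]; ring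
  rw [h1, integral_sub ((Literature.Analysis.Fourier.integrable_mul_cos hh T).const_mul _)
    ((Literature.Analysis.Fourier.integrable_mul_sin hh T).const_mul _), integral_const_mul, integral_const_mul]

/-- **Riemann–Lebesgue uniformly in the phase**: for integrable `h` and `δ > 0`, eventually in `T`,
`|∫ h(x) cos(Tx + φ) dx| ≤ δ` for EVERY phase `φ`. [folklore] -/
theorem eventually_abs_integral_mul_cos_add_le {h : ℝ → ℝ} (hh : Integrable h) {δ : ℝ} (hδ : 0 < δ) :
    ∀ᶠ T : ℝ in atTop, ∀ φ : ℝ, |∫ x, h x * Real.cos (T * x + φ)| ≤ δ := by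
  have hc := (tendsto_integral_mul_cos_atTop hh).eventually_mem (Metric.ball_mem_nhds (0 : ℝ) (half_pos hδ))
  have hs := (tendsto_integral_mul_sin_atTop hh).eventually_mem (Metric.ball_mem_nhds (0 : ℝ) (half_pos hδ))
  filter_upwards [hc, hs] with T hcT hsT φ
  rw [Metric.mem_ball, dist_zero_right, Real.norm_eq_abs] at hcT hsT
  rw [integral_mul_cos_add h hh T φ]
  have h1 : |Real.cos φ * ∫ x, h x * Real.cos (T * x)| ≤ |∫ x, h x * Real.cos (T * x)| := by
    rw [abs_mul]; exact mul_le_of_le_one_left (abs_nonneg _) (Real.abs_cos_le_one _)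
  have h2 : |Real.sin φ * ∫ x, h x * Real.sin (T * x)| ≤ |∫ x, h x * Real.sin (T * x)| := by
    rw [abs_mul]; exact mul_le_of_le_one_left (abs_nonneg _) (Real.abs_sin_le_one _)
  have := abs_sub _ _ |>.trans (add_le_add h1 h2)
  linarith

/-! ## §2 Resonant frequencies (Dirichlet's simultaneous approximation along `log n/log 2`) -/

/-- **Resonant frequencies are unbounded**: for every finite set `S` of naturals, every `T₀` and every `η > 0` there is `T ≥ T₀` with
`cos(T·log n) ≥ 1 − η` for all `n ∈ S`.  (Dirichlet, MV Lemma 15.10, for the numbers `log n/log 2` with denominator bound `R·N`;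
`T = 2πRq/log 2`.) [cite: MontgomeryVaughan2007, Lemma 15.10] -/
theorem exists_resonant_frequency (S : Finset ℕ) (T₀ : ℝ) {η : ℝ} (hη : 0 < η) :
    ∃ T : ℝ, T₀ ≤ T ∧ ∀ n ∈ S, 1 - η ≤ Real.cos (T * Real.log n) := by
  classical
  -- the multiplier `R ≥ max T₀ 1` and the precision `N ≥ 2π²/η`
  set R : ℕ := ⌈max T₀ 0⌉₊ + 1 with hR
  set N : ℕ := ⌈2 * π ^ 2 / η⌉₊ + 1 with hN
  have hR1 : (1 : ℝ) ≤ R := by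
    rw [hR]; push_cast; linarith [(Nat.cast_nonneg (⌈max T₀ 0⌉₊) : (0 : ℝ) ≤ _)]
  have hRT : T₀ ≤ R := by
    rw [hR]; push_cast
    have := Nat.le_ceil (max T₀ 0)
    linarith [le_max_left T₀ 0]
  have hN1 : (1 : ℝ) ≤ N := by
    rw [hN]; push_cast; linarith [(Nat.cast_nonneg (⌈2 * π ^ 2 / η⌉₊) : (0 : ℝ) ≤ _)]
  have hNη : 2 * π ^ 2 / η ≤ N := by
    rw [hN]; push_cast; linarith [Nat.le_ceil (2 * π ^ 2 / η)]
  have hRNpos : 0 < R * N := by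
    have h1 : 0 < R := by rw [hR]; omega
    have h2 : 0 < N := by rw [hN]; omega
    exact Nat.mul_pos h1 h2
  obtain ⟨q, hq0, -, hround⟩ :=
    exists_nat_forall_abs_sub_round_lt (ι := ↥S) (fun n ↦ Real.log (n : ℕ) / Real.log 2) hRNpos
  have hlog2 : 0 < Real.log 2 := Real.log_pos (by norm_num)
  refine ⟨2 * π * R * q / Real.log 2, ?_, fun n hn ↦ ?_⟩
  · -- `T ≥ 2πR/log 2 ≥ R ≥ T₀`
    have hq1 : (1 : ℝ) ≤ q := by exact_mod_cast hq0
    have h1 : (R : ℝ) ≤ 2 * π * R * q / Real.log 2 := by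
      rw [le_div_iff₀ hlog2]
      have hl : Real.log 2 ≤ 1 := by
        have := Real.log_two_lt_d9; linarith
      have hR0 : (0 : ℝ) ≤ R := by linarith
      have h3 : (R : ℝ) * 1 ≤ R * q := by gcongr
      have h4 : (R : ℝ) * Real.log 2 ≤ R * 1 := by gcongr
      nlinarith [mul_nonneg hR0 (show (0 : ℝ) ≤ q by linarith), Real.pi_gt_three, h3, h4]
    exact hRT.trans h1
  · -- `T log n = 2π·(R·q·log n/log 2)` and `R·q·log n/log 2` is within `R/(RN) = 1/N` of the integer `R·round(q log n/log 2)`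
    have hn' := hround ⟨n, hn⟩
    simp only at hn'
    set x := Real.log (n : ℕ) / Real.log 2 * q with hx
    set m : ℤ := round x with hm
    have hRN : (0 : ℝ) < (R * N : ℕ) := by exact_mod_cast hRNpos
    have hδ : |x - m| < 1 / (R * N : ℕ) := hn'
    have harg : 2 * π * R * q / Real.log 2 * Real.log n = 2 * π * (R * (x - m)) + (R * m : ℤ) * (2 * π) := by
      rw [hx]; push_cast; field_simp; ring
    rw [harg, Real.cos_add_int_mul_two_pi]
    -- `|2πR(x − m)| ≤ 2π/N`, so `cos ≥ 1 − (2π/N)²/2 = 1 − 2π²/N² ≥ 1 − η`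
    have hR0 : (0 : ℝ) ≤ R := by linarith
    have hRpos : (0 : ℝ) < R := by linarith
    have hNpos : (0 : ℝ) < N := by linarith
    have hb : |R * (x - m)| ≤ 1 / N := by
      rw [abs_mul, abs_of_nonneg hR0]
      have h' : |x - ↑m| < 1 / ((R : ℝ) * N) := by
        have := hδ; push_cast at this; exact this
      calc (R : ℝ) * |x - m| ≤ R * (1 / (R * N)) := by gcongr
        _ = 1 / N := by field_simp
    have hcos := Real.one_sub_sq_div_two_le_cos (x := 2 * π * (R * (x - m)))
    have hsq : (2 * π * (R * (x - m))) ^ 2 / 2 ≤ η := by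
      have hy : (R * (x - m)) ^ 2 ≤ (1 / N) ^ 2 := by
        calc (R * (x - m)) ^ 2 = |R * (x - m)| ^ 2 := (sq_abs _).symm
          _ ≤ (1 / N) ^ 2 := pow_le_pow_left₀ (abs_nonneg _) hb 2
      have hN2 : (1 / (N : ℝ)) ^ 2 ≤ 1 / N := by
        rw [div_pow, one_pow]
        exact div_le_div_of_nonneg_left (by norm_num) hNpos (by nlinarith)
      have h6 : (R * (x - m)) ^ 2 ≤ 1 / N := hy.trans hN2
      have h5 : 2 * π ^ 2 ≤ η * N := by
        have := (div_le_iff₀ hη).1 hNη; linarith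
      have h7 : 2 * π ^ 2 / N ≤ η := by rw [div_le_iff₀ hNpos]; linarith
      calc (2 * π * (R * (x - m))) ^ 2 / 2 = 2 * π ^ 2 * (R * (x - m)) ^ 2 := by ring
        _ ≤ 2 * π ^ 2 * (1 / N) := by gcongr
        _ = 2 * π ^ 2 / N := by ring
        _ ≤ η := h7
    linarith

/-! ## §3 Modulated window functions -/

/-- A modulated admissible function `g·cos(T· + θ)` is admissible with the same bound and support. -/
theorem modulated_admissible {g : ℝ → ℝ} {C : ℝ} (hg : Measurable g) (hC : ∀ x, |g x| ≤ C)
    (hsupp : ∀ x, x ∉ Icc (-a) a → g x = 0) (T θ : ℝ) :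
    Measurable (fun x ↦ g x * Real.cos (T * x + θ)) ∧ (∀ x, |g x * Real.cos (T * x + θ)| ≤ C) ∧
      (∀ x, x ∉ Icc (-a) a → g x * Real.cos (T * x + θ) = 0) := by
  refine ⟨hg.mul (by fun_prop), fun x ↦ ?_, fun x hx ↦ by rw [hsupp x hx, zero_mul]⟩
  rw [abs_mul]
  have hC0 : 0 ≤ C := (abs_nonneg _).trans (hC 0)
  calc |g x| * |Real.cos (T * x + θ)| ≤ C * 1 :=
        mul_le_mul (hC x) (Real.abs_cos_le_one _) (abs_nonneg _) hC0
    _ = C := mul_one C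

/-- The shifted products `g(x − ℓ)g(x)` of an admissible `g` are integrable. -/
theorem integrable_shift_mul {g : ℝ → ℝ} {C : ℝ} (hg : Measurable g) (hC : ∀ x, |g x| ≤ C)
    (hsupp : ∀ x, x ∉ Icc (-a) a → g x = 0) (ℓ : ℝ) :
    Integrable (fun x ↦ g (x - ℓ) * g x) := by
  have h := integrable_shift_mul_shift hg hC hsupp ℓ 0
  refine h.congr (Eventually.of_forall fun x ↦ ?_)
  simp only [sub_zero]

/-- **The modulation identity**: for `f = g·cos(T· + θ)`,
`∫ f(x − ℓ) f(x) dx = (cos(Tℓ)/2)·∫ g(x − ℓ)g(x) dx + ½ ∫ g(x − ℓ)g(x)·cos(2T·x + (2θ − Tℓ)) dx`. -/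
theorem integral_modulated_shift_mul {g : ℝ → ℝ} {C : ℝ} (hg : Measurable g) (hC : ∀ x, |g x| ≤ C)
    (hsupp : ∀ x, x ∉ Icc (-a) a → g x = 0) (T θ ℓ : ℝ) :
    ∫ x, (g (x - ℓ) * Real.cos (T * (x - ℓ) + θ)) * (g x * Real.cos (T * x + θ))
      = Real.cos (T * ℓ) / 2 * (∫ x, g (x - ℓ) * g x)
        + 1 / 2 * ∫ x, (g (x - ℓ) * g x) * Real.cos (2 * T * x + (2 * θ - T * ℓ)) := by
  have hpt : ∀ x, (g (x - ℓ) * Real.cos (T * (x - ℓ) + θ)) * (g x * Real.cos (T * x + θ))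
      = Real.cos (T * ℓ) / 2 * (g (x - ℓ) * g x)
        + 1 / 2 * ((g (x - ℓ) * g x) * Real.cos (2 * T * x + (2 * θ - T * ℓ))) := by
    intro x
    have hprod : Real.cos (T * (x - ℓ) + θ) * Real.cos (T * x + θ)
        = (Real.cos (T * ℓ) + Real.cos (2 * T * x + (2 * θ - T * ℓ))) / 2 := by
      have key : ∀ A B : ℝ, 2 * (Real.cos A * Real.cos B) = Real.cos (A - B) + Real.cos (A + B) :=
        fun A B ↦ by rw [Real.cos_sub, Real.cos_add]; ring
      have h := key (T * (x - ℓ) + θ) (T * x + θ)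
      rw [show T * (x - ℓ) + θ - (T * x + θ) = -(T * ℓ) by ring, Real.cos_neg,
        show T * (x - ℓ) + θ + (T * x + θ) = 2 * T * x + (2 * θ - T * ℓ) by ring] at h
      linarith
    calc (g (x - ℓ) * Real.cos (T * (x - ℓ) + θ)) * (g x * Real.cos (T * x + θ))
        = (g (x - ℓ) * g x) * (Real.cos (T * (x - ℓ) + θ) * Real.cos (T * x + θ)) := by ring
      _ = _ := by rw [hprod]; ring
  have hI := integrable_shift_mul hg hC hsupp ℓ
  have hI2 : Integrable (fun x ↦ (g (x - ℓ) * g x) * Real.cos (2 * T * x + (2 * θ - T * ℓ))) :=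
    integrable_mul_cos_add hI _ _
  simp_rw [hpt]
  rw [integral_add (hI.const_mul _) (hI2.const_mul _), integral_const_mul, integral_const_mul]

/-- The square of a modulated function: `∫ (g cos(T· + θ))² = ½∫g² + ½∫ g²·cos(2T·x + 2θ)`. -/
theorem integral_modulated_sq {g : ℝ → ℝ} {C : ℝ} (hg : Measurable g) (hC : ∀ x, |g x| ≤ C)
    (hsupp : ∀ x, x ∉ Icc (-a) a → g x = 0) (T θ : ℝ) :
    ∫ x, (g x * Real.cos (T * x + θ)) ^ 2
      = 1 / 2 * (∫ x, g x ^ 2) + 1 / 2 * ∫ x, g x ^ 2 * Real.cos (2 * T * x + 2 * θ) := by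
  have h := integral_modulated_shift_mul hg hC hsupp T θ 0
  simp only [sub_zero, mul_zero, Real.cos_zero] at h
  have h1 : (fun x ↦ (g x * Real.cos (T * x + θ)) ^ 2)
      = fun x ↦ (g x * Real.cos (T * x + θ)) * (g x * Real.cos (T * x + θ)) := funext fun x ↦ pow_two _
  have h2 : (fun x ↦ g x ^ 2) = fun x ↦ g x * g x := funext fun x ↦ pow_two _
  have h3 : (fun x ↦ g x ^ 2 * Real.cos (2 * T * x + 2 * θ)) = fun x ↦ g x * g x * Real.cos (2 * T * x + 2 * θ) :=
    funext fun x ↦ by rw [pow_two]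
  rw [h1, h, h2, h3]

/-- `|∫ g(x − ℓ) g(x)| ≤ ∫ g²` for admissible `g` (Cauchy–Schwarz via `2|uv| ≤ u² + v²` and translation invariance). -/
theorem abs_integral_shift_mul_le {g : ℝ → ℝ} {C : ℝ} (hg : Measurable g) (hC : ∀ x, |g x| ≤ C)
    (hsupp : ∀ x, x ∉ Icc (-a) a → g x = 0) (ℓ : ℝ) :
    |∫ x, g (x - ℓ) * g x| ≤ ∫ x, g x ^ 2 := by
  have hI := integrable_shift_mul hg hC hsupp ℓ
  have hsq : Integrable (fun x ↦ g x ^ 2) := by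
    have := integrable_shift_mul hg hC hsupp 0
    exact this.congr (Eventually.of_forall fun x ↦ by simp only [sub_zero, pow_two])
  have hsqs : Integrable (fun x ↦ g (x - ℓ) ^ 2) := hsq.comp_sub_right ℓ
  have hshift : ∫ x, g (x - ℓ) ^ 2 = ∫ x, g x ^ 2 := integral_sub_right_eq_self (fun x ↦ g x ^ 2) ℓ
  have h1 : |∫ x, g (x - ℓ) * g x| ≤ ∫ x, |g (x - ℓ) * g x| := abs_integral_le_integral_abs
  have h2 : ∫ x, |g (x - ℓ) * g x| ≤ ∫ x, (g (x - ℓ) ^ 2 + g x ^ 2) / 2 := by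
    refine integral_mono hI.abs ((hsqs.add hsq).div_const 2) fun x ↦ ?_
    simp only
    rw [abs_mul]
    nlinarith [sq_nonneg (|g (x - ℓ)| - |g x|), sq_abs (g (x - ℓ)), sq_abs (g x)]
  have h3 : ∫ x, (g (x - ℓ) ^ 2 + g x ^ 2) / 2 = ∫ x, g x ^ 2 := by
    rw [integral_div, integral_add hsqs hsq, hshift]; ring
  linarith

/-! ## §4 The free phase makes the modulated function orthogonal to any direction -/

/-- For bounded measurable `c` and admissible `g` there is a phase `θ` with `∫ g(x)cos(Tx + θ)·c(x) dx = 0`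
(the integral is `A cos θ − B sin θ`, which changes sign between `θ = 0` and `θ = π`). -/
theorem exists_phase_orthogonal {g c : ℝ → ℝ} {C Cc : ℝ} (hg : Measurable g) (hC : ∀ x, |g x| ≤ C)
    (hsupp : ∀ x, x ∉ Icc (-a) a → g x = 0) (hcm : Measurable c) (hCc : ∀ x, |c x| ≤ Cc) (T : ℝ) :
    ∃ θ : ℝ, ∫ x, g x * Real.cos (T * x + θ) * c x = 0 := by
  have hgc : Integrable (fun x ↦ g x * c x) := FloorPerturbation.integrable_mul hg hcm hC hCc hsupp
  set A := ∫ x, (g x * c x) * Real.cos (T * x) with hA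
  set B := ∫ x, (g x * c x) * Real.sin (T * x) with hB
  have hF : ∀ θ, ∫ x, g x * Real.cos (T * x + θ) * c x = A * Real.cos θ - B * Real.sin θ := by
    intro θ
    have h1 : (fun x ↦ g x * Real.cos (T * x + θ) * c x) = fun x ↦ (g x * c x) * Real.cos (T * x + θ) := by
      funext x; ring
    rw [h1, integral_mul_cos_add _ hgc T θ, hA, hB]; ring
  set F : ℝ → ℝ := fun θ ↦ A * Real.cos θ - B * Real.sin θ with hFdef
  have hcont : Continuous F := by rw [hFdef]; fun_prop
  have h0 : F 0 = A := by simp [hFdef]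
  have hπ : F π = -A := by simp [hFdef]
  have hmem : (0 : ℝ) ∈ uIcc (F 0) (F π) := by
    rw [h0, hπ, mem_uIcc]
    rcases le_or_gt 0 A with hA0 | hA0
    · exact Or.inr ⟨by linarith, hA0⟩
    · exact Or.inl ⟨hA0.le, by linarith⟩
  obtain ⟨θ, -, hθ⟩ := intermediate_value_uIcc hcont.continuousOn hmem
  exact ⟨θ, by rw [hF θ]; exact hθ⟩

end FloorResonance

end Summit.RiemannHypothesis.RiemannHypothesis.Theorems.WeilFormatC
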